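import Mathlib
import HarnessLib
import Summits.NavierStokesRegularity.NavierStokesRegularity.Theorems.TaylorModelRungThreeCertificateFormatVLoop
import Summits.NavierStokesRegularity.NavierStokesRegularity.Theorems.TaylorModelRungThreeVRadiiDefs

/-!
# Crux K1b-DR (stmt-NavierStokesRegularity-23954), line `taylor-model` — v3 certificate INTERPRETATION: the stage context
# `ctxOf` (instantiating the loop with typer g32's `coreStep`), and the semantic records `toCertDataV`, `toBoxes`,
# `toRadii` presented by a `CertTablesV` (CERT-CONTRACT-23954 v3.1 §2/§5 «generated Lean»; successor engine-1 g67)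

Definitions only (soundness in `…FormatVInterpLemmas` / `…FormatVRadiiSound`). Given the v3 tables `TV : CertTablesV` and a
chosen `CoreKit` (coefficient boxes + monomial table for the field twin, the box-inflation exponent, the `Vc` precision, the
trial `L1₀` — all CHOSEN objects; the soundness theorems assume only `CoefBoxOK`/`mt = monosTable`):

* per stage `j` the loop context `TV.ctxOf kit j : StageCtx` — core := `TV.base.coreStep` on the stage's `κ·ω`, `ω`, `ω⁻¹`
  boxes (`ofQS2` enclosures of the exact table scalars), field twin := `qBboxMA`, tube half-widths `tubeW` (upper ends of
  `Λdes·κ·ω`), centres/steps/emitted states from the tables, ENTRY node (`Vc := diag D`, `e := 0`, `B := I`, `rp := 0`,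
  `Z := 0`); accessors `nodeV`, `subV`, `coreV`; hull radii `radL l` (level 0: `|B|rp`; 1: `|Vc|rB + e + |B|rp`; 2: `+ wT`);
* the SEMANTIC RECORDS: `toCertDataV TV kit sc : CertData` = the v1 static interpretation `TV.base.toCertData` with the
  node/sub-step fields REPLACED — centres `x` (dyadic), jets `P j s m := taylorJet Qb (x j s) m` and variational jets
  `Wv := varJet … (trunc v)` (so the a-block recursions hold BY DEFINITION), frames `Cm := linF (dre B)`, `Ci := linF (invMat B)`
  (the true inverse; exists by the Neumann node test), `rP := rp`, `L1` from the core, `h`, `Tn`; the v1 scalar outputs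
  (`mC … κB`) are supplied by the read-outs side through `ScalarsV` (not read by `ChainV`); `toBoxes TV kit : StepBoxes`
  (hulls, core boxes/jets, `Mlo/Mhi` = the entries of the core's `M` read through `idx`); `toRadii TV kit : RadiiData`
  (`rB`, `Dsc := linF (dre (diag D))`, `Vc`, `e`, `ν := nuOf`, `Zlo/Zhi`).

MODEL-lattice rung TL-M3 only; nothing here is a statement about the Navier–Stokes equations, and nothing is asserted.
-/

-- the sub-problem namespace repeats the summit name by design (D-0017)
set_option linter.dupNamespace false

namespace Summit.NavierStokesRegularity.NavierStokesRegularity.Theorems.TaylorModelCert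

open scoped BigOperators
open Literature.Analysis.FluidPDE.TaoCascade Literature.Analysis.FluidPDE.TaoCascade.TaylorChain
open Summit.NavierStokesRegularity.NavierStokesRegularity.Theorems.TaylorModelReadout
open Summit.NavierStokesRegularity.NavierStokesRegularity.Theorems.TaylorModelV

/-! ### Chosen kit, small builders -/

/-- The CHOSEN core kit: coefficient boxes and monomial table of the field twin, box-inflation exponent, `Vc` precision,
trial row factor. [folklore] -/
structure CoreKit where
  /-- coefficient boxes (sound ones: `CertTables.CoefBoxOK`) -/
  coefB : Fin 4 → Fin 4 → Fin 4 → ℕ → ℤ → IntervalD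
  /-- active-monomial table (`= T.monosTable coefB`) -/
  mt : Array (List (ℕ × ℕ × ℕ))
  /-- box-inflation exponent and `Vc` rounding precision -/
  (infl precV : ℕ)
  /-- first trial `L1` -/
  L1₀ : Dyad

/-- Diagonal dyadic matrix. [folklore] -/
def diagD (n : ℕ) (D : Array Dyad) : Array (Array Dyad) :=
  Array.ofFn (n := n) fun r => Array.ofFn (n := n) fun c => if (r : ℕ) = c then dget D r else Dyad.zero

/-- Identity dyadic matrix. [folklore] -/
def identD (n : ℕ) : Array (Array Dyad) :=
  Array.ofFn (n := n) fun r => Array.ofFn (n := n) fun c => if (r : ℕ) = c then Dyad.one else Dyad.zero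

/-- Zero dyadic vector. [folklore] -/
def zeroV (n : ℕ) : Array Dyad := Array.ofFn (n := n) fun _ => Dyad.zero

/-- Zero interval matrix. [folklore] -/
def zeroIM (n : ℕ) : Array (Array IntervalD) :=
  Array.ofFn (n := n) fun _ => Array.ofFn (n := n) fun _ => IntervalD.ofInt 0

/-- Real lower ends `x − r` of a box around `x`. [folklore] -/
noncomputable def loOf (x r : Array Dyad) (c : ℕ) : ℝ := vre x c - vre r c

/-- Real upper ends `x + r` of a box around `x`. [folklore] -/
noncomputable def hiOf (x r : Array Dyad) (c : ℕ) : ℝ := vre x c + vre r c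

/-- The inverse of a dyadic matrix in coordinates (Mathlib's `Matrix.inv` on the `n × n` block; junk off the block and
when singular — used only under the Neumann test). [folklore] -/
noncomputable def invMat (n : ℕ) (B : Array (Array Dyad)) (r c : ℕ) : ℝ :=
  if hr : r < n then (if hc : c < n then (toMat n (dre B))⁻¹ ⟨r, hr⟩ ⟨c, hc⟩ else 0) else 0

namespace CertTables

variable {K : Type} (T : CertTables K)

/-- Lower-end KERNEL of an interval matrix in window coordinates. [folklore] -/
noncomputable def kerLo (M : Array (Array IntervalD)) : Ker := fun i' k' i k => (imget M (T.idx i' k') (T.idx i k)).lo.toReal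

/-- Upper-end KERNEL of an interval matrix in window coordinates. [folklore] -/
noncomputable def kerHi (M : Array (Array IntervalD)) : Ker := fun i' k' i k => (imget M (T.idx i' k') (T.idx i k)).hi.toReal

end CertTables

/-! ### The stage context of a v3 certificate -/

namespace CertTablesV

variable (TV : CertTablesV) (kit : CoreKit)

/-- Per-coordinate enclosures of `κ_j·ω_j`. [folklore] -/
def κωB (j : ℕ) : Array IntervalD :=
  Array.ofFn (n := TV.base.n) fun c =>
    IntervalD.mulR TV.prec (IntervalD.ofQS2 TV.prec (TV.base.stage j).κ) (IntervalD.ofQS2 TV.prec (TV.base.wgt j c))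

/-- Per-coordinate enclosures of `ω_j`. [folklore] -/
def ωB (j : ℕ) : Array IntervalD := Array.ofFn (n := TV.base.n) fun c => IntervalD.ofQS2 TV.prec (TV.base.wgt j c)

/-- Per-coordinate enclosures of `ω_j⁻¹` (exact field inverse, then enclosed). [folklore] -/
def ωinvB (j : ℕ) : Array IntervalD := Array.ofFn (n := TV.base.n) fun c => IntervalD.ofQS2 TV.prec (TV.base.wgt j c)⁻¹

/-- Tube inflation half-widths `wT_c ≥ Λdes_j·κ_j·ω_j` (upper ends). [folklore] -/
def tubeW (j : ℕ) : Array Dyad :=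
  Array.ofFn (n := TV.base.n) fun c =>
    (IntervalD.mulR TV.prec (IntervalD.ofQS2 TV.prec (TV.stageV j).Λdes) (IntervalD.aget (TV.κωB j) c)).hi

/-- The ENTRY node state of stage `j`: `Vc := diag D_j`, `e := 0`, `B := I`, `rp := 0`, `Z := 0`. [folklore] -/
def entryNode (j : ℕ) : NodeSt :=
  mkNode TV.base.n TV.prec TV.precB (diagD TV.base.n (TV.stageV j).D) (zeroV TV.base.n) (identD TV.base.n)
    (zeroV TV.base.n) (zeroIM TV.base.n)

/-- The core function of stage `j`: one attempt of typer g32's `coreStep` on the stage's boxes. [folklore] -/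
def coreF (j : ℕ) : Array IntervalD → Dyad → Dyad → CoreOut := fun H2 h L1 =>
  TV.base.coreStep
    { coefB := kit.coefB, mt := kit.mt, prec := TV.prec, p := TV.base.pdeg, pV := TV.pdegV, infl := kit.infl,
      H2 := H2, h := h, κωB := TV.κωB j, ωB := TV.ωB j, ωinvB := TV.ωinvB j, L1 := L1 }

/-- **The loop context of stage `j`.** [folklore] -/
def ctxOf (j : ℕ) : StageCtx :=
  { n := TV.base.n, prec := TV.prec, precV := kit.precV, precB := TV.precB, p := TV.base.pdeg,
    rB := (TV.stageV j).rB, wT := TV.tubeW j, L1₀ := kit.L1₀, core := TV.coreF kit j,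
    QBA := TV.base.qBboxMA kit.coefB TV.prec kit.mt, x := TV.xD j, h := TV.hD j, E := TV.nodeE j,
    N0 := TV.entryNode j }

/-- Node state `(j, s)`. [folklore] -/
def nodeV (j s : ℕ) : NodeSt := (TV.ctxOf kit j).nodeAt s

/-- Sub-step output `(j, s)`. [folklore] -/
def subV (j s : ℕ) : StageCtx.SubOut := (TV.ctxOf kit j).subStep s (TV.nodeV kit j s)

/-- Core output `(j, s)`. [folklore] -/
def coreV (j s : ℕ) : CoreOut := (TV.subV kit j s).core

/-- Hull radii by level: `0 ↦ |B|·rp`, `1 ↦ |Vc|·rB + e + |B|·rp`, `2 ↦ level 1 + wT`. [folklore] -/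
def radL (j : ℕ) (l : Fin 3) (N : NodeSt) : Array Dyad :=
  match l with
  | ⟨0, _⟩ => absMulVecUp TV.base.n TV.prec (absD TV.base.n N.B) N.rp
  | ⟨1, _⟩ => (TV.ctxOf kit j).hullRad N
  | ⟨_ + 2, _⟩ => addVecUp TV.base.n TV.prec ((TV.ctxOf kit j).hullRad N) (TV.tubeW j)

/-! ### The semantic records -/

/-- The v1 per-node / per-sub-step SCALAR outputs (`mC … κB`), supplied by the read-outs side; `ChainV` does not read them.
[folklore] -/
structure ScalarsV where
  (mC mT EI E EO ρ ρO NVh NV dP SpI Sp SpO NCi κB : ℕ → ℕ → ℝ)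

/-- **The `CertData` record presented by a v3 certificate** (see the module docstring). [folklore] -/
noncomputable def toCertDataV (sc : ScalarsV) : CertData :=
  { TV.base.toCertData QS2.toRealHom with
    h := fun j s => TV.hR j s
    Tn := fun j s => TV.TnR j s
    x := fun j s => TV.xR j s
    P := fun j s m => taylorJet (TV.base.toCertData QS2.toRealHom).Qb (TV.xR j s) m
    Wv := fun j s m v =>
      if m ≤ TV.pdegV then varJet (TV.base.toCertData QS2.toRealHom).Qb (TV.xR j s)
        (trunc (TV.base.toCertData QS2.toRealHom) v) m else 0
    Cm := fun j s => TV.base.linF (dre (TV.nodeV kit j s).B)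
    Ci := fun j s => TV.base.linF (invMat TV.base.n (TV.nodeV kit j s).B)
    rP := fun j s => TV.base.vecF (vre (TV.nodeV kit j s).rp)
    L1 := fun j s => (TV.coreV kit j s).L1.toReal
    mC := sc.mC, mT := sc.mT, EI := sc.EI, E := sc.E, EO := sc.EO, ρ := sc.ρ, ρO := sc.ρO, NVh := sc.NVh, NV := sc.NV
    dP := sc.dP, SpI := sc.SpI, Sp := sc.Sp, SpO := sc.SpO, NCi := sc.NCi, κB := sc.κB }

/-- **The `StepBoxes` record presented by a v3 certificate.** [folklore] -/
noncomputable def toBoxes : StepBoxes where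
  pdegV := TV.pdegV
  rPl := fun _ j s => TV.base.vecF (vre (TV.nodeV kit j s).rp)
  hlo := fun l j s => TV.base.vecF (loOf (TV.xD j s) (TV.radL kit j l (TV.nodeV kit j s)))
  hhi := fun l j s => TV.base.vecF (hiOf (TV.xD j s) (TV.radL kit j l (TV.nodeV kit j s)))
  lo := fun j s => TV.base.vecF (vre (TV.coreV kit j s).lo)
  hi := fun j s => TV.base.vecF (vre (TV.coreV kit j s).hi)
  loK := fun j s => TV.base.vecF (vre (TV.coreV kit j s).loK)
  hiK := fun j s => TV.base.vecF (vre (TV.coreV kit j s).hiK)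
  loV := fun j s => TV.base.vecF (vre (TV.coreV kit j s).loV)
  hiV := fun j s => TV.base.vecF (vre (TV.coreV kit j s).hiV)
  J := fun j s => TV.base.vecF (vre (TV.coreV kit j s).J)
  JU := fun j s => TV.base.vecF (vre (TV.coreV kit j s).JU)
  Mlo := fun j s => TV.base.kerLo (TV.coreV kit j s).M
  Mhi := fun j s => TV.base.kerHi (TV.coreV kit j s).M

/-- **The `RadiiData` record presented by a v3 certificate.** [folklore] -/
noncomputable def toRadii : RadiiData where
  rB := fun j => TV.base.vecF (vre (TV.stageV j).rB)
  Dsc := fun j => TV.base.linF (dre (diagD TV.base.n (TV.stageV j).D))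
  Vc := fun j s => TV.base.linF (dre (TV.nodeV kit j s).Vc)
  e := fun j s => TV.base.vecF (vre (TV.nodeV kit j s).e)
  ν := fun j s => TV.base.vecF (vre ((TV.ctxOf kit j).nuOf (TV.coreV kit j s) s))
  Zlo := fun j s => TV.base.kerLo (TV.nodeV kit j s).Z
  Zhi := fun j s => TV.base.kerHi (TV.nodeV kit j s).Z

end CertTablesV

end Summit.NavierStokesRegularity.NavierStokesRegularity.Theorems.TaylorModelCert
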